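import Mathlib
import HarnessLib
import Summits.Ventures.LatticeQCDFlow.Scoring.DoeblinGreenKubo

/-!
# Green–Kubo for a kernel minorised by an ARBITRARY law: `K^t g = const + (1−ε)^t R^t g`, sup-norm
# decay of centred observables, and `Σ_t C_f(t) = ⟨f, h⟩_π` for every bounded Poisson solution `h`

HONEST FRAMING: exact (Metropolis-corrected) sampling algorithms for lattice gauge theory;
figures of merit are autocorrelation/cost numbers at stated couplings and volumes; no
continuum-physics claim.

Venture `LatticeQCDFlow` (cell pub-lqcd), topic `Scoring`; FANOUT row 8 (`s0-cpn-nemc`, GEN-17).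
NEW WORK of the cell, not a published result; no definition is introduced.  `Scoring/DoeblinGreenKubo.lean`
proved the windowless Green–Kubo law for a kernel minorised by ITS OWN invariant law (`κ(x, ·) ≥ ε π`),
where the rank-one part kills centred observables (`K^t f̄ = (1−ε)^t R^t f̄`).  The split chain of the
row's regenerative chapter (`Scoring/SplitChain*.lean`) is built from a minorisation by an ARBITRARY
probability law `ν` (`κ(x, ·) ≥ ε ν`, the generic situation for a non-equilibrium / flow proposal whose
reference law is not the target), and the identification of its tour variance with the asymptotic
variance (`Scoring/TourVarianceGeneral.lean`) needs Green–Kubo in that generality.  The one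
observation: iterating `K = ε ν(·) + (1−ε) R` on a bounded observable gives
`K^t g = c_t + (1−ε)^t R^t g` with a CONSTANT `c_t` (all the `ν`-terms are constants, and `R` fixes
constants), so for `π` invariant and `f̄` centred `K^t f̄ = (1−ε)^t (R^t f̄ − π(R^t f̄))`, whence the
sup-norm decay `|K^t f̄| ≤ 2C(1−ε)^t` — Doeblin's theorem on observables, with no coupling and no
total variation — and then the Green–Kubo `HasSum` of `Scoring/DoeblinGreenKubo.lean` goes through
verbatim for every bounded measurable Poisson solution.  Printed counterpart NAMED ONLY: uniform
ergodicity under a Doeblin minorisation (Doeblin 1938; Meyn–Tweedie 1993 Thm 16.2.4, whose residual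
kernel is the tree's `Literature.Probability.MarkovChains.Doeblin.residualKernel`) and the Poisson-
equation form of the asymptotic variance (Meyn–Tweedie Thm 17.4.4) — nothing is cited as a fact.

## Content (`e = ε.toReal`; `κ` Markov, `ν` ANY probability law with `κ(x, B) ≥ ε ν(B)`, `ε < 1`;
## `R = Doeblin.residualKernel κ ν ε hmin`; `π` an invariant probability law; `|f| ≤ C`, `π(f) = 0`)

* `kop_affine_apply` — `kop η (c + a·h) = c + a · kop η h`;
* **`iterate_kop_eq_const_add_residual`** — `∃ c, (kop κ)^[t] g = c + (1−e)^t (kop R)^[t] g`;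
* **`iterate_kop_centred_eq_residual`** — `(kop κ)^[t] f x = (1−e)^t ((kop R)^[t] f x − π((kop R)^[t] f))`;
* **`abs_iterate_kop_centred_le_minorised`** — SUP-NORM DECAY `|(kop κ)^[t] f x| ≤ 2C(1−e)^t`;
  `abs_autocov_le_minorised` — `|C_f(t)| ≤ 2C²(1−e)^t`;
* `tendsto_integral_mul_iterate_kop_minorised`, **`greenKubo_hasSum_minorised`** (`0 < ε`) —
  `HasSum (t ↦ ∫ f · (kop κ)^[t] f dπ) (∫ f h dπ)` for every bounded measurable `h` with `h − kop κ h = f`;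
  `poisson_inner_eq_minorised` — `⟨f, h⟩_π` is the same for all such `h`;
  **`poisson_exists_minorised`** — the Neumann series `Σ_t (kop κ)^[t] f` is one, `|h| ≤ 2C/e`.

NOT CLAIMED: total-variation statements (the tree's Literature file has Doeblin's theorem setwise);
optimal rates; anything at `ε = 1` (then `κ x = ν` for all `x`); any `ε` of a concrete sampler.
-/

noncomputable section

namespace Summit.Ventures.LatticeQCDFlow.Scoring

open MeasureTheory ProbabilityTheory Filter Literature.Probability.MarkovChains
open scoped ENNReal Topology

variable {Ω : Type*} [MeasurableSpace Ω]

/-! ### `kop` on affine images -/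

section Affine

variable (η : Kernel Ω Ω) [IsMarkovKernel η]

/-- `kop η (c + a · h) (x) = c + a · kop η h x` for bounded measurable `h` (Markov kernel). -/
theorem kop_affine_apply {h : Ω → ℝ} (hh : Measurable h) {C : ℝ} (hC : ∀ x, |h x| ≤ C)
    (c a : ℝ) (x : Ω) : kop η (fun y => c + a * h y) x = c + a * kop η h x := by
  unfold kop
  rw [integral_add (integrable_const c) ((integrable_of_bounded _ hh hC).const_mul a),
    integral_const, probReal_univ, one_smul, integral_const_mul]

/-- An affine image of a bounded measurable observable is bounded measurable. -/
theorem affine_bounded_measurable {h : Ω → ℝ} (hh : Measurable h) {C : ℝ} (hC : ∀ x, |h x| ≤ C)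
    (c a : ℝ) : Measurable (fun y => c + a * h y) ∧ ∀ y, |c + a * h y| ≤ |c| + |a| * C := by
  refine ⟨measurable_const.add (hh.const_mul a), fun y => ?_⟩
  calc |c + a * h y| ≤ |c| + |a * h y| := abs_add_le _ _
    _ ≤ |c| + |a| * C := by
        rw [abs_mul]
        exact add_le_add le_rfl (mul_le_mul_of_nonneg_left (hC y) (abs_nonneg a))

end Affine

/-! ### Iterates of a minorised kernel: constants plus residual moves -/

section Decay

variable {κ : Kernel Ω Ω} [IsMarkovKernel κ] {ν : Measure Ω} [IsProbabilityMeasure ν] {ε : ℝ≥0∞}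
  {hmin : ∀ x {B : Set Ω}, MeasurableSet B → ε * ν B ≤ κ x B}

omit [MeasurableSpace Ω] in
/-- Bookkeeping: `(1 − ε).toReal = 1 − ε.toReal`, `0 ≤ 1 − ε.toReal`, `ε.toReal < 1` for `ε < 1`. -/
theorem one_sub_toReal_eq_of_lt_one (hε : ε < 1) :
    (1 - ε).toReal = 1 - ε.toReal ∧ 0 ≤ 1 - ε.toReal ∧ ε.toReal < 1 := by
  have h1 : ε.toReal < 1 := by
    have := (ENNReal.toReal_lt_toReal (ne_top_of_lt hε) ENNReal.one_ne_top).2 hε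
    rwa [ENNReal.toReal_one] at this
  exact ⟨by rw [ENNReal.toReal_sub_of_le hε.le ENNReal.one_ne_top, ENNReal.toReal_one],
    by linarith, h1⟩

/-- **Iterating `K = ε ν(·) + (1 − ε) R` on a bounded observable**: for every `t` there is a
CONSTANT `c` with `(kop κ)^[t] g = c + (1 − e)^t · (kop R)^[t] g` (the `ν`-terms are constants, and the
Markov operator `kop R` fixes constants). -/
theorem iterate_kop_eq_const_add_residual (hε : ε < 1) {g : Ω → ℝ} (hg : Measurable g) {C : ℝ}
    (hC : ∀ x, |g x| ≤ C) : ∀ t : ℕ, ∃ c : ℝ, (kop κ)^[t] g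
      = fun x => c + (1 - ε.toReal) ^ t * (kop (Doeblin.residualKernel κ ν ε hmin))^[t] g x
  | 0 => ⟨0, funext fun x => by simp⟩
  | t + 1 => by
    haveI := Doeblin.isMarkovKernel_residualKernel (κ := κ) (ν := ν) (hmin := hmin) hε
    obtain ⟨c, hc⟩ := iterate_kop_eq_const_add_residual hε hg hC t
    obtain ⟨hm, hb⟩ := iterate_kop_bounded_measurable (Doeblin.residualKernel κ ν ε hmin) hg hC t
    obtain ⟨hr, -, -⟩ := one_sub_toReal_eq_of_lt_one (ε := ε) hε
    obtain ⟨hFm, hFb⟩ := affine_bounded_measurable hm hb c ((1 - ε.toReal) ^ t)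
    refine ⟨ε.toReal * (∫ y, (c + (1 - ε.toReal) ^ t
        * (kop (Doeblin.residualKernel κ ν ε hmin))^[t] g y) ∂ν) + (1 - ε.toReal) * c, ?_⟩
    rw [Function.iterate_succ_apply', hc]
    funext x
    rw [kop_eq_add_residual (κ := κ) (π := ν) (hmin := hmin) hε hFm hFb x,
      kop_affine_apply _ hm hb c ((1 - ε.toReal) ^ t) x, hr,
      Function.iterate_succ_apply' (kop (Doeblin.residualKernel κ ν ε hmin)) t g]
    ring

variable {π : Measure Ω} [IsProbabilityMeasure π]

/-- **Centred observables**: for `π` invariant and `π(f) = 0`,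
`(kop κ)^[t] f x = (1 − e)^t · ((kop R)^[t] f x − ∫ (kop R)^[t] f dπ)` — the constant is fixed by
`π((kop κ)^[t] f) = π(f) = 0`. -/
theorem iterate_kop_centred_eq_residual (hπ : Kernel.Invariant κ π) (hε : ε < 1) {f : Ω → ℝ}
    (hf : Measurable f) {C : ℝ} (hC : ∀ x, |f x| ≤ C) (hf0 : ∫ x, f x ∂π = 0) (t : ℕ) (x : Ω) :
    (kop κ)^[t] f x = (1 - ε.toReal) ^ t * ((kop (Doeblin.residualKernel κ ν ε hmin))^[t] f x
      - ∫ y, (kop (Doeblin.residualKernel κ ν ε hmin))^[t] f y ∂π) := by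
  haveI := Doeblin.isMarkovKernel_residualKernel (κ := κ) (ν := ν) (hmin := hmin) hε
  obtain ⟨c, hc⟩ := iterate_kop_eq_const_add_residual (κ := κ) (ν := ν) (hmin := hmin) hε hf hC t
  obtain ⟨hm, hb⟩ := iterate_kop_bounded_measurable (Doeblin.residualKernel κ ν ε hmin) hf hC t
  have hint : ∫ y, (kop κ)^[t] f y ∂π = 0 := by rw [integral_iterate_kop κ hπ hf hC t, hf0]
  rw [hc] at hint
  have hint' : c + (1 - ε.toReal) ^ t
      * ∫ y, (kop (Doeblin.residualKernel κ ν ε hmin))^[t] f y ∂π = 0 := by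
    have h := hint
    simp only at h
    rw [integral_add (integrable_const c) ((integrable_of_bounded π hm hb).const_mul _),
      integral_const, probReal_univ, one_smul, integral_const_mul] at h
    exact h
  rw [hc]
  simp only
  linarith

/-- **SUP-NORM DECAY OF CENTRED OBSERVABLES (Doeblin, on observables)**: for `π` invariant,
`κ(x, ·) ≥ ε ν` with `ε < 1`, `|f| ≤ C` measurable and `π(f) = 0`:
`|(kop κ)^[t] f x| ≤ 2C · (1 − e)^t` for all `t`, `x`. -/
theorem abs_iterate_kop_centred_le_minorised (hπ : Kernel.Invariant κ π)
    (hmin : ∀ x {B : Set Ω}, MeasurableSet B → ε * ν B ≤ κ x B) (hε : ε < 1) {f : Ω → ℝ}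
    (hf : Measurable f) {C : ℝ} (hC : ∀ x, |f x| ≤ C) (hf0 : ∫ x, f x ∂π = 0) (t : ℕ) (x : Ω) :
    |(kop κ)^[t] f x| ≤ 2 * C * (1 - ε.toReal) ^ t := by
  haveI := Doeblin.isMarkovKernel_residualKernel (κ := κ) (ν := ν) (hmin := hmin) hε
  obtain ⟨-, hr0, -⟩ := one_sub_toReal_eq_of_lt_one (ε := ε) hε
  obtain ⟨hm, hb⟩ := iterate_kop_bounded_measurable (Doeblin.residualKernel κ ν ε hmin) hf hC t
  have hI : |∫ y, (kop (Doeblin.residualKernel κ ν ε hmin))^[t] f y ∂π| ≤ C := by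
    calc |∫ y, (kop (Doeblin.residualKernel κ ν ε hmin))^[t] f y ∂π|
        = ‖∫ y, (kop (Doeblin.residualKernel κ ν ε hmin))^[t] f y ∂π‖ := (Real.norm_eq_abs _).symm
      _ ≤ C * π.real Set.univ := norm_integral_le_of_norm_le_const (Eventually.of_forall fun y => by
          rw [Real.norm_eq_abs]; exact hb y)
      _ = C := by rw [probReal_univ, mul_one]
  rw [iterate_kop_centred_eq_residual (κ := κ) (ν := ν) (hmin := hmin) hπ hε hf hC hf0 t x, abs_mul,
    abs_of_nonneg (pow_nonneg hr0 t)]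
  calc (1 - ε.toReal) ^ t * |(kop (Doeblin.residualKernel κ ν ε hmin))^[t] f x
        - ∫ y, (kop (Doeblin.residualKernel κ ν ε hmin))^[t] f y ∂π|
      ≤ (1 - ε.toReal) ^ t * (C + C) := mul_le_mul_of_nonneg_left
        ((abs_sub _ _).trans (add_le_add (hb x) hI)) (pow_nonneg hr0 t)
    _ = 2 * C * (1 - ε.toReal) ^ t := by ring

/-- **Geometric envelope of the autocovariance**: `|∫ f · (kop κ)^[t] f dπ| ≤ 2C² (1 − e)^t`. -/
theorem abs_autocov_le_minorised (hπ : Kernel.Invariant κ π)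
    (hmin : ∀ x {B : Set Ω}, MeasurableSet B → ε * ν B ≤ κ x B) (hε : ε < 1) {f : Ω → ℝ}
    (hf : Measurable f) {C : ℝ} (hC : ∀ x, |f x| ≤ C) (hf0 : ∫ x, f x ∂π = 0) (t : ℕ) :
    |autocov κ π f t| ≤ 2 * C ^ 2 * (1 - ε.toReal) ^ t := by
  have hC0 : 0 ≤ C := (abs_nonneg _).trans (hC (Classical.choice (nonempty_of_isProbabilityMeasure π)))
  have hdecay := fun y =>
    abs_iterate_kop_centred_le_minorised (κ := κ) (ν := ν) (hmin := hmin) hπ hε hf hC hf0 t y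
  unfold autocov
  calc |∫ y, f y * (kop κ)^[t] f y ∂π| = ‖∫ y, f y * (kop κ)^[t] f y ∂π‖ := (Real.norm_eq_abs _).symm
    _ ≤ C * (2 * C * (1 - ε.toReal) ^ t) * π.real Set.univ :=
        norm_integral_le_of_norm_le_const (Eventually.of_forall fun y => by
          rw [Real.norm_eq_abs, abs_mul]
          exact mul_le_mul (hC y) (hdecay y) (abs_nonneg _) hC0)
    _ = 2 * C ^ 2 * (1 - ε.toReal) ^ t := by rw [probReal_univ, mul_one]; ring

/-! ### Green–Kubo from any bounded Poisson solution -/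

/-- **The boundary term vanishes**: `∫ f · (kop κ)^[T] h dπ → 0` for `f` bounded measurable centred
and `h` bounded measurable (`0 < ε < 1`). -/
theorem tendsto_integral_mul_iterate_kop_minorised (hπ : Kernel.Invariant κ π)
    (hmin : ∀ x {B : Set Ω}, MeasurableSet B → ε * ν B ≤ κ x B) (hε0 : 0 < ε) (hε : ε < 1)
    {f h : Ω → ℝ} (hf : Measurable f) {Cf : ℝ} (hCf : ∀ x, |f x| ≤ Cf) (hf0 : ∫ x, f x ∂π = 0)
    (hh : Measurable h) {Ch : ℝ} (hCh : ∀ x, |h x| ≤ Ch) :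
    Tendsto (fun T => ∫ x, f x * (kop κ)^[T] h x ∂π) atTop (𝓝 0) := by
  obtain ⟨-, hl0, he1⟩ := one_sub_toReal_eq_of_lt_one (ε := ε) hε
  have he0 : 0 < ε.toReal := ENNReal.toReal_pos hε0.ne' (ne_top_of_lt hε)
  have hl1 : 1 - ε.toReal < 1 := by linarith
  have hCf0 : ∀ x, 0 ≤ Cf := fun x => (abs_nonneg _).trans (hCf x)
  -- the centred part of `h`
  set m : ℝ := ∫ x, h x ∂π with hm
  have hcm : Measurable fun x => h x - m := hh.sub measurable_const
  have hcb : ∀ x, |h x - m| ≤ Ch + |m| := fun x =>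
    (abs_sub _ _).trans (add_le_add (hCh x) le_rfl)
  have hc0 : ∫ x, (h x - m) ∂π = 0 := by
    rw [integral_sub (integrable_of_bounded π hh hCh) (integrable_const m), integral_const,
      probReal_univ, one_smul, hm, sub_self]
  have hdecay := fun T x =>
    abs_iterate_kop_centred_le_minorised (κ := κ) (ν := ν) (hmin := hmin) hπ hε hcm hcb hc0 T x
  -- `∫ f · Kᵀ h = ∫ f · Kᵀ (h − m)` since `∫ f = 0`
  have hsplit : ∀ T, ∫ x, f x * (kop κ)^[T] h x ∂π
      = ∫ x, f x * (kop κ)^[T] (fun y => h y - m) x ∂π := by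
    intro T
    obtain ⟨hmT, hbT⟩ := iterate_kop_bounded_measurable κ hcm hcb T
    have hfun := iterate_kop_sub_const (κ := κ) hh hCh m T
    have hpt : ∀ x, f x * (kop κ)^[T] h x = f x * (kop κ)^[T] (fun y => h y - m) x + m * f x := by
      intro x
      rw [hfun]
      ring
    have hi1 : Integrable (fun x => f x * (kop κ)^[T] (fun y => h y - m) x) π :=
      integrable_of_bounded π (hf.mul hmT) (C := Cf * (Ch + |m|)) fun x => by
        rw [abs_mul]
        exact mul_le_mul (hCf x) (hbT x) (abs_nonneg _) (hCf0 x)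
    have hi2 : Integrable (fun x => m * f x) π := (integrable_of_bounded π hf hCf).const_mul m
    rw [integral_congr_ae (ae_of_all _ hpt), integral_add hi1 hi2, integral_const_mul, hf0,
      mul_zero, add_zero]
  -- bound and squeeze
  have hbound : ∀ T, |∫ x, f x * (kop κ)^[T] h x ∂π|
      ≤ Cf * (2 * (Ch + |m|)) * (1 - ε.toReal) ^ T := by
    intro T
    rw [hsplit T]
    calc |∫ x, f x * (kop κ)^[T] (fun y => h y - m) x ∂π|
        = ‖∫ x, f x * (kop κ)^[T] (fun y => h y - m) x ∂π‖ := (Real.norm_eq_abs _).symm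
      _ ≤ Cf * (2 * (Ch + |m|) * (1 - ε.toReal) ^ T) * π.real Set.univ :=
          norm_integral_le_of_norm_le_const (ae_of_all _ fun x => by
            rw [Real.norm_eq_abs, abs_mul]
            exact mul_le_mul (hCf x) (hdecay T x) (abs_nonneg _) (hCf0 x))
      _ = Cf * (2 * (Ch + |m|)) * (1 - ε.toReal) ^ T := by rw [probReal_univ, mul_one]; ring
  have hg : Tendsto (fun T : ℕ => Cf * (2 * (Ch + |m|)) * (1 - ε.toReal) ^ T) atTop (𝓝 0) := by
    simpa using (tendsto_pow_atTop_nhds_zero_of_lt_one hl0 hl1).const_mul (Cf * (2 * (Ch + |m|)))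
  exact squeeze_zero_norm (fun T => by rw [Real.norm_eq_abs]; exact hbound T) hg

/-- **GREEN–KUBO FOR A KERNEL MINORISED BY ANY LAW.**  `π` an invariant probability law of the Markov
kernel `κ`, `κ(x, ·) ≥ ε ν` for some probability law `ν` and `0 < ε < 1`, `f` bounded measurable
`π`-centred, `h` a bounded measurable solution of the Poisson equation `h − kop κ h = f`:
`Σ_{t ≥ 0} ∫ f · (kop κ)^[t] f dπ = ∫ f h dπ` (as a `HasSum`). -/
theorem greenKubo_hasSum_minorised (hπ : Kernel.Invariant κ π)
    (hmin : ∀ x {B : Set Ω}, MeasurableSet B → ε * ν B ≤ κ x B) (hε0 : 0 < ε) (hε : ε < 1)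
    {f h : Ω → ℝ} (hf : Measurable f) {Cf : ℝ} (hCf : ∀ x, |f x| ≤ Cf) (hf0 : ∫ x, f x ∂π = 0)
    (hh : Measurable h) {Ch : ℝ} (hCh : ∀ x, |h x| ≤ Ch) (hpois : ∀ x, h x - kop κ h x = f x) :
    HasSum (fun t => autocov κ π f t) (∫ x, f x * h x ∂π) := by
  have henv := fun t => abs_autocov_le_minorised (κ := κ) (ν := ν) hπ hmin hε hf hCf hf0 t
  obtain ⟨-, hl0, he1⟩ := one_sub_toReal_eq_of_lt_one (ε := ε) hε
  have he0 : 0 < ε.toReal := ENNReal.toReal_pos hε0.ne' (ne_top_of_lt hε)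
  have hl1 : 1 - ε.toReal < 1 := by linarith
  have hsum : Summable fun t => autocov κ π f t :=
    Summable.of_norm_bounded
      ((summable_geometric_of_lt_one hl0 hl1).mul_left (2 * Cf ^ 2)) fun t => by
        rw [Real.norm_eq_abs]; exact henv t
  rw [hsum.hasSum_iff_tendsto_nat]
  have hpart : (fun T => ∑ t ∈ Finset.range T, autocov κ π f t)
      = fun T => ∫ x, f x * h x ∂π - ∫ x, f x * (kop κ)^[T] h x ∂π :=
    funext fun T => sum_autocov_eq_of_poisson hf hCf hh hCh hpois T
  rw [hpart]
  simpa using (tendsto_integral_mul_iterate_kop_minorised (κ := κ) (ν := ν) hπ hmin hε0 hε hf hCf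
    hf0 hh hCh).const_sub (∫ x, f x * h x ∂π)

/-- The Green–Kubo functional `⟨f, h⟩_π` does not depend on WHICH bounded measurable Poisson
solution `h` is used (kernel minorised by any law, `0 < ε < 1`). -/
theorem poisson_inner_eq_minorised (hπ : Kernel.Invariant κ π)
    (hmin : ∀ x {B : Set Ω}, MeasurableSet B → ε * ν B ≤ κ x B) (hε0 : 0 < ε) (hε : ε < 1)
    {f h h' : Ω → ℝ} (hf : Measurable f) {Cf : ℝ} (hCf : ∀ x, |f x| ≤ Cf) (hf0 : ∫ x, f x ∂π = 0)
    (hh : Measurable h) {Ch : ℝ} (hCh : ∀ x, |h x| ≤ Ch) (hpois : ∀ x, h x - kop κ h x = f x)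
    (hh' : Measurable h') {Ch' : ℝ} (hCh' : ∀ x, |h' x| ≤ Ch')
    (hpois' : ∀ x, h' x - kop κ h' x = f x) :
    ∫ x, f x * h x ∂π = ∫ x, f x * h' x ∂π :=
  (greenKubo_hasSum_minorised hπ hmin hε0 hε hf hCf hf0 hh hCh hpois).unique
    (greenKubo_hasSum_minorised hπ hmin hε0 hε hf hCf hf0 hh' hCh' hpois')

/-- **A bounded measurable Poisson solution EXISTS** for every bounded measurable `π`-centred `f`
(kernel minorised by any law, `0 < ε < 1`): the Neumann series `h = Σ_t (kop κ)^[t] f` converges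
absolutely by the sup-norm decay, `|h| ≤ 2C/e`, and `h − kop κ h = f`. -/
theorem poisson_exists_minorised (hπ : Kernel.Invariant κ π)
    (hmin : ∀ x {B : Set Ω}, MeasurableSet B → ε * ν B ≤ κ x B) (hε0 : 0 < ε) (hε : ε < 1)
    {f : Ω → ℝ} (hf : Measurable f) {C : ℝ} (hC : ∀ x, |f x| ≤ C) (hf0 : ∫ x, f x ∂π = 0) :
    ∃ h : Ω → ℝ, Measurable h ∧ (∀ x, |h x| ≤ 2 * C / ε.toReal) ∧
      ∀ x, h x - kop κ h x = f x := by
  obtain ⟨-, hl0, he1⟩ := one_sub_toReal_eq_of_lt_one (ε := ε) hε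
  have he0 : 0 < ε.toReal := ENNReal.toReal_pos hε0.ne' (ne_top_of_lt hε)
  have hl1 : 1 - ε.toReal < 1 := by linarith
  have hC0 : 0 ≤ C := (abs_nonneg _).trans (hC (Classical.choice (nonempty_of_isProbabilityMeasure π)))
  have hdecay := fun t x =>
    abs_iterate_kop_centred_le_minorised (κ := κ) (ν := ν) (hmin := hmin) hπ hε hf hC hf0 t x
  have hgeo : HasSum (fun t : ℕ => 2 * C * (1 - ε.toReal) ^ t) (2 * C / ε.toReal) := by
    have h := (hasSum_geometric_of_lt_one hl0 hl1).mul_left (2 * C)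
    have he : 2 * C * (1 - (1 - ε.toReal))⁻¹ = 2 * C / ε.toReal := by
      rw [sub_sub_cancel, div_eq_mul_inv]
    rwa [he] at h
  have hsum : ∀ x, Summable fun t => (kop κ)^[t] f x := fun x =>
    Summable.of_norm_bounded hgeo.summable fun t => by
      rw [Real.norm_eq_abs]; exact hdecay t x
  -- partial sums
  set S : ℕ → Ω → ℝ := fun N x => ∑ t ∈ Finset.range N, (kop κ)^[t] f x with hS
  have hSm : ∀ N, Measurable (S N) := fun N =>
    Finset.measurable_sum _ fun t _ => (iterate_kop_bounded_measurable κ hf hC t).1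
  have hSb : ∀ N x, |S N x| ≤ 2 * C / ε.toReal := by
    intro N x
    calc |S N x| ≤ ∑ t ∈ Finset.range N, |(kop κ)^[t] f x| := Finset.abs_sum_le_sum_abs _ _
      _ ≤ ∑ t ∈ Finset.range N, 2 * C * (1 - ε.toReal) ^ t :=
          Finset.sum_le_sum fun t _ => hdecay t x
      _ ≤ 2 * C / ε.toReal :=
          sum_le_hasSum _ (fun t _ => mul_nonneg (by positivity) (pow_nonneg hl0 t)) hgeo
  have hlim : ∀ x, Tendsto (fun N => S N x) atTop (𝓝 (∑' t, (kop κ)^[t] f x)) := fun x =>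
    (hsum x).hasSum.tendsto_sum_nat
  refine ⟨fun x => ∑' t, (kop κ)^[t] f x, ?_, ?_, fun x => ?_⟩
  · exact measurable_of_tendsto_metrizable hSm (tendsto_pi_nhds.2 hlim)
  · intro x
    have h1 := tsum_of_norm_bounded hgeo fun t => by rw [Real.norm_eq_abs]; exact hdecay t x
    rwa [Real.norm_eq_abs] at h1
  · have hrec : ∀ N, S (N + 1) x = f x + kop κ (S N) x := by
      intro N
      have hlin : kop κ (S N) x = ∑ t ∈ Finset.range N, (kop κ)^[t + 1] f x := by
        show ∫ y, (∑ t ∈ Finset.range N, (kop κ)^[t] f y) ∂(κ x) = _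
        rw [integral_finsetSum _ fun t _ => ?_]
        · refine Finset.sum_congr rfl fun t _ => ?_
          rw [Function.iterate_succ_apply']
          rfl
        · obtain ⟨hm, hb⟩ := iterate_kop_bounded_measurable κ hf hC t
          exact integrable_of_bounded _ hm hb
      rw [hlin]
      show ∑ t ∈ Finset.range (N + 1), (kop κ)^[t] f x = _
      rw [Finset.sum_range_succ']
      simp only [Function.iterate_zero, id_eq]
      ring
    have hdct : Tendsto (fun N => kop κ (S N) x) atTop
        (𝓝 (kop κ (fun y => ∑' t, (kop κ)^[t] f y) x)) := by
      unfold kop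
      refine tendsto_integral_of_dominated_convergence (fun _ => 2 * C / ε.toReal)
        (fun N => (hSm N).aestronglyMeasurable) (integrable_const _) (fun N => ae_of_all _ fun y => ?_)
        (ae_of_all _ fun y => hlim y)
      rw [Real.norm_eq_abs]
      exact hSb N y
    have hlim1 : Tendsto (fun N => S (N + 1) x) atTop (𝓝 (∑' t, (kop κ)^[t] f x)) :=
      (hlim x).comp (tendsto_add_atTop_nat 1)
    have hlim2 : Tendsto (fun N => S (N + 1) x) atTop
        (𝓝 (f x + kop κ (fun y => ∑' t, (kop κ)^[t] f y) x)) := by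
      have := hdct.const_add (f x)
      exact this.congr fun N => (hrec N).symm
    have heq := tendsto_nhds_unique hlim1 hlim2
    linarith

end Decay

end Summit.Ventures.LatticeQCDFlow.Scoring

end
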